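import Summits.BirchSwinnertonDyer.Rank1Residual.ManinAdditive.FrickeValueDegreeLaws
import Literature.NumberTheory.EllipticCurves.AtkinLehnerFrickeLevelProofs
import Literature.NumberTheory.EllipticCurves.CuspFormLFunctionFrickeProofs
import Literature.NumberTheory.EllipticCurves.ModularParametrizationDegree
import HarnessLib

/-!
# LEMMA H PROVED: the support row E-es-H `FrickeValueTwoSmul` holds (ref1 §R213; es g37 MEMO-es §58.1)

For a modular parametrisation datum `D` of level `N` with `w_N f = −f` and `φ` `Γ₀(N)`-invariant, `2 • φ(τ_N) = t_N`, where
`τ_N = i/√N` is the Fricke fixed point (`frickeFixedPoint N`, `FrickeValueDegreeLaws.lean`) and `t_N = D.atkinLehnerCuspPoint N` is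
the Atkin–Lehner cusp point (`φ` at the cusp `0`).  PROVED from tree theorems only: `φ_atkinLehnerW_smul` (`φ ∘ w(Q) = ε•φ + t_Q`) at
`Q := N`, `atkinLehnerInvolution_self_eq_frickeInvolution` (`w_{Q=N} = w_N`), `glCast_atkinLehnerW_self` (`w(N) = γ₀ · w_N`,
`γ₀ ∈ Γ₀(N)`), `coe_frickeGL_smul` (`w_N • τ = −1/(Nτ)`), and — for the unconditional form — `φ_gamma0_smul_holds'`.  Hence the
support row `AtkinLehnerDegree.FrickeValueTwoSmul` (p754203; a plain `def … : Prop`, es's LEMMA H) is DISCHARGED: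
`AtkinLehnerDegree.FrickeValueTwoSmul_holds`.

TYPER NOTE (typer g21, ref1 TURNKEY 02:25Z).  SOURCE = HOME/ref1/e213/ProofEesH.lean sha16 9f1c0721e9347aa7 (67 l.; ref1: farm rc 0·0·0·0,
axioms standard; REFUTER-ref1 §R213, pack HOME/ref1/e213/ + SHA16SUMS; «a refuter may not land positive rows») VERBATIM but for: (i) namespace
`RefuterProofR213` → the row's namespace `Summit.BirchSwinnertonDyer.Rank1Residual.ManinAdditive.AtkinLehnerDegree` and the discharge renamed
`frickeValueTwoSmul_holds` → `FrickeValueTwoSmul_holds` (the tree's `<Decl>_holds` convention; helper names `coe_frickeFixedPoint`,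
`frickeGL_smul_frickeFixedPoint`, `two_nsmul_φ_frickeFixedPoint` kept); (ii) this module docstring replaces ref1's scratch header;
(iii) `import HarnessLib`.  No statement is introduced or changed (theorem-only file, kind proof).  bears_on: stmt-BirchSwinnertonDyer-22967
(C2 `ManinOddAtFour`) — E-es-H is the support lemma of THEOREM S / M♮ (rows E-es-179/180, laws, untouched).  BSD is not proved by this;
Manin c = 1 not proved; C2/C3 OPEN (priced «⟸ Stevens I (strong) via E-an-242, N6 ∧ N7 open»).
-/


open scoped MatrixGroups ModularForm UpperHalfPlane
open CongruenceSubgroup WeierstrassCurve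
open Literature.NumberTheory.EllipticCurves Literature.NumberTheory.EllipticCurves.ModularForms
open Summit.BirchSwinnertonDyer.Rank1Residual.ManinAdditive.ConwayCut
open Summit.BirchSwinnertonDyer.Rank1Residual.ManinAdditive.AtkinLehnerDegree

namespace Summit.BirchSwinnertonDyer.Rank1Residual.ManinAdditive.AtkinLehnerDegree

/-- The Fricke fixed point as a complex number: `τ_N = i/√N`. -/
theorem coe_frickeFixedPoint (N : ℕ) [NeZero N] :
    ((frickeFixedPoint N : ℍ) : ℂ) = ((Real.sqrt (N : ℝ))⁻¹ : ℝ) * Complex.I := by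
  apply Complex.ext
  · simp [frickeFixedPoint]
  · simp only [frickeFixedPoint, Complex.mul_im, Complex.ofReal_re, Complex.I_im, Complex.ofReal_im,
      Complex.I_re, mul_one, mul_zero, add_zero]

/-- `w_N` fixes `τ_N = i/√N`. -/
theorem frickeGL_smul_frickeFixedPoint (N : ℕ) [NeZero N] :
    glCast (frickeGL N : GL (Fin 2) ℚ) • frickeFixedPoint N = frickeFixedPoint N := by
  apply UpperHalfPlane.ext
  rw [coe_frickeGL_smul, coe_frickeFixedPoint]
  have hN : (0 : ℝ) < N := by exact_mod_cast NeZero.pos N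
  have hs : Real.sqrt (N : ℝ) ≠ 0 := (Real.sqrt_pos.mpr hN).ne'
  have hsC : ((Real.sqrt (N : ℝ) : ℝ) : ℂ) ≠ 0 := by exact_mod_cast hs
  have hsq : ((Real.sqrt (N : ℝ) : ℝ) : ℂ) * ((Real.sqrt (N : ℝ) : ℝ) : ℂ) = (N : ℂ) := by
    rw [← Complex.ofReal_mul, Real.mul_self_sqrt hN.le]; push_cast; rfl
  rw [Complex.ofReal_inv]
  have h1 : (N : ℂ) * ((((Real.sqrt (N : ℝ) : ℝ) : ℂ))⁻¹ * Complex.I) =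
      ((Real.sqrt (N : ℝ) : ℝ) : ℂ) * Complex.I := by
    rw [← hsq, mul_assoc, mul_inv_cancel_left₀ hsC]
  rw [h1, mul_inv, Complex.inv_I, mul_neg, neg_neg]

/-- **E-es-H** (LEMMA H): for `w_N f = −f`, `2 • φ(τ_N) = t_N` (`= φ` at the cusp `0`). -/
theorem FrickeValueTwoSmul_holds : FrickeValueTwoSmul := by
  intro W _ N _ D hγ hF
  have hε : atkinLehnerInvolution N 2 N D.f = (((-1 : ℤ) : ℂ)) • D.f := by
    rw [atkinLehnerInvolution_self_eq_frickeInvolution, hF]; simp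
  have key := D.φ_atkinLehnerW_smul (dvd_refl N)
    (by rw [Nat.div_self (NeZero.pos N)]; exact Nat.coprime_one_right N) hε (frickeFixedPoint N)
  have hfix : D.φ (glCast (atkinLehnerW N N : GL (Fin 2) ℚ) • frickeFixedPoint N) =
      D.φ (frickeFixedPoint N) := by
    rw [glCast_atkinLehnerW_self N, mul_smul, frickeGL_smul_frickeFixedPoint]
    exact hγ ⟨_, frickeTwist_mem_Gamma0 N⟩ (frickeFixedPoint N)
  rw [hfix, neg_one_zsmul] at key
  have h2 : D.φ (frickeFixedPoint N) + D.φ (frickeFixedPoint N) = D.atkinLehnerCuspPoint N := by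
    calc D.φ (frickeFixedPoint N) + D.φ (frickeFixedPoint N)
        = (-D.φ (frickeFixedPoint N) + D.atkinLehnerCuspPoint N) + D.φ (frickeFixedPoint N) := by rw [← key]
      _ = D.atkinLehnerCuspPoint N := by abel
  simpa [two_nsmul] using h2

/-- Unconditional form: the hypothesis `φ_gamma0_smul` is a tree theorem. -/
theorem two_nsmul_φ_frickeFixedPoint {W : WeierstrassCurve ℚ} [W.IsElliptic] {N : ℕ} [NeZero N]
    (D : ModularParametrizationData W N) (hF : frickeInvolution N 2 D.f = -D.f) :
    (2 : ℕ) • D.φ (frickeFixedPoint N) = D.atkinLehnerCuspPoint N :=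
  FrickeValueTwoSmul_holds W D D.φ_gamma0_smul_holds' hF

end Summit.BirchSwinnertonDyer.Rank1Residual.ManinAdditive.AtkinLehnerDegree
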